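/-
COR-CM (cells pub-hodgecm / pub-hodgecm2, stage 2 of the Hodge ladder) — TEAM hCMisogE (coordinator ruling «FINISH AS FAST AS POSSIBLE»
2026-08-21T18:44:30Z (1); seat hcmisog-glue gen 2 = prover-pub-hodgecm2-hcmisog-glue-g2-0; path pre-ACKed by lead gen 8, HOME/INBOX BATCH #16
2026-08-21T23:01:03Z; hodge-director 22:54:20Z «R1 tree twin = your call»).  The tree twin of the X2-RECONCILIATION residual R1 = R-X2a
(«equivariant-isogeny record construction»): kernel content = htheta-x2 gen 6's read-only probe `probe_x2_det45_principal_v2.lean`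
(bc7d10990bfd, farm rc 0 on tree imports), re-typed in the tree namespace with its predicate `PrincipalTail` INLINED (theorems only: no
definition, no instance, no named fact, no `sorry`).  FRAMING: HC_CM is NOT proved; S2 is NOT closed; no binder and no count moves.
-/
import Summits.HodgeConjecture.CorCM.B01.Transposition.Item6PinMatchDef45
import HarnessLib

/-!
# Item (vi) S2, CM side: the PRINCIPAL ∕ EQUIVARIANT form of `hCMisogE` at [Liu 2021] Def. 4.5 (2), and the transport of
Liu's eigenclass along the isogeny (X2 reconciliation, residual R-X2a)

The binder-discharging theorem of record `Model.hCMisogE_of_det45` (`Item6PinMatchDef45.lean` :203, p301919) exports, at every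
admissible face, the tail `∃ B g, IsIsogeny g ∧ ∃ ιB θB, IsCMTypeRealisation Ψ̃_μ B ιB θB` — with NO stated relation between the
isogeny `g : A_μ ⊗_{E,ι₁} ℂ ⟶ B` and the two actions.  Behind it, binder-1's data-bearing theorem
`ComplexMultiplication.exists_principal_isCMTypeRealisation_of_cmType_eq` (`CMTypeOfHodgeDeterminant.lean` :78; Shimura 1998
§7.1 Prop. 7, Mumford §19) carries the full record: an isogeny PAIR `(u : A ⟶ B, v : B ⟶ A, m)` with `u ≫ v = m • 𝟙`,
`v ≫ u = m • 𝟙`, an INTEGRAL action `ιB : 𝓞_K → End B` through which the TRANSPORTED rational structure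
`φ_B := End⁰(u,v,m) ∘ φ` factors on `𝓞_K`, and `θB := complexAction φ_B`.  This file threads that record through the Def. 4.5 (2)
chain (§2 = the tree's proofs of `Item6PinMatchDet` :125 / `Item6PinMatchDef45` :129 verbatim with the last lemma swapped) up to the
face-guarded family with EXACTLY the carriers and binders of `Model.hCMisogE_of_det45` (§3), and proves the functoriality sentence the
package reading of Liu's datum asks for (§1, §4): for a non-zero `τ`-eigenclass `α ∈ H¹(A(ℂ);ℂ)` of Liu's action, `α_B := v^*α` is a
non-zero `τ`-eigenclass of `θB` and every generator `f^*α` (`f : P ⟶ A`) equals `m⁻¹ • (f ≫ u)^* α_B` — the consumed «⊆ span»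
direction, with no inverse on `H¹`.

* §1 `complexBetti_map_comp_complexAction_transport` (`v^* ∘ complexAction φ k = complexAction φ_B k ∘ v^*` on `H¹(−(ℂ);ℂ)`: the
  tree's rational `pull_comp_hOneAlgHom_transport` for the reversed pair `(v, u)`, complexified through `β`),
  `complexBetti_map_mem_eigenline_transport`, `complexBetti_map_map_of_comp_eq_nsmul` (`u^*(v^*α) = m • α`),
  `complexBetti_map_injective_of_comp_eq_nsmul`, `complexBetti_map_eq_inv_smul_map_comp` (`f^*α = m⁻¹ • (f ≫ u)^*(v^*α)`),
  `exists_eigenline_transport_of_isogenyPair` (packaged).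
* §2 `exists_principal_isCMTypeRealisation_of_det_complexAction` (one complex abelian variety), `…_baseChange_of_detInvariant` (one
  `A / E`; twin of `Item6PinMatchDet` :125), `…_baseChange_of_det45` ([Liu 2021] Def. 4.5 (2) data; twin of `Item6PinMatchDef45` :129).
* §3 `hCMisogE_of_det45_principal` — SAME carriers `D Aμ₀ iμ₀` and binders `hW hdetBC hdim hdet45` as `Model.hCMisogE_of_det45`,
  conclusion = the principal record at every face; `hCMisogE_of_principal` — the principal family implies the exported `∃`-tail.
* §4 `exists_isCMTypeRealisation_eigenline_transport_of_principal` — R-X2a end to end: principal record + non-zero `τ`-eigenclass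
  `α` ⟹ `(B, u, ιB, θB, m, α_B)` with `IsIsogeny u`, `IsCMTypeRealisation Φ B ιB θB`, `α_B ∈ eigenline θB τ`, `α_B ≠ 0` and the
  generator identity for every `f : P ⟶ A`.

READING / STRENGTH.  Hypotheses of §3 are token-identical with `Model.hCMisogE_of_det45` :203–220 (`hW` = tree theorem
`cotangent_hodge10_comparison_holds`, `hdetBC` = tree theorem `AbelianVariety.det_cotangentMap_baseChange`, then Liu's Def. 4.5 (2)
data AS PRINTED under the face guard `IsGalois ℚ F → 6 ≤ [F:ℚ] → ι₁ ∈ Φ`); only the conclusion is STRONGER (the record instead of its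
`∃`-shadow).  NOT done here: the two kernels' reflex-pair token identification (residual R-X2b, port-literal); Liu's eigenclass `α`
itself (X1); inhabiting any display binder; HC_CM.  Kernel content first certified by htheta-x2 gen 6 (read-only probes
`probe_x2_det45_principal.lean` 71c3f0bf4f56, `…_v2.lean` bc7d10990bfd; HOME/INBOX 2026-08-21T22:21:48Z / 22:49:48Z).

References: Y. Liu, *Fourier–Jacobi cycles and arithmetic relative trace formula*, Camb. J. Math. 9 (2021) = arXiv:2102.11518,
Def. 4.5 (`FJcycle.tex` ll. 1936–1964), Prop. 4.6 (1) l. 1969; G. Shimura, *Abelian Varieties with Complex Multiplication and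
Modular Functions* (1998) §5.2 (pp. 36–37), §7.1 Prop. 7 (p. 47); D. Mumford, *Abelian Varieties* (1970) §19 (Remark p. 169,
p. 176); P. Deligne, *Hodge cycles on abelian varieties*, LNM 900 (1982) §4, Example 3.7.
-/

noncomputable section

open scoped TensorProduct

namespace Summit.HodgeConjecture.CorCM.Model

open CategoryTheory NumberField
open Literature.AlgebraicGeometry.Motives Literature.AlgebraicGeometry.HodgeTheory
open Literature.AlgebraicGeometry.ComplexMultiplication Literature.AlgebraicGeometry.Milne1999
open Literature.AlgebraicGeometry.Motives.HodgeStructure Literature.AlgebraicGeometry.Motives.AbelianVariety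
open Literature.NumberTheory.ComplexMultiplication Literature.NumberTheory.Automorphic
open Literature.NumberTheory.Automorphic.IdeleClassGroup Literature.NumberTheory.Automorphic.PicardCM
open Literature.NumberTheory.Automorphic.Liu2021

/-! ## §1  Transport of `H¹(−(ℂ);ℂ)`-classes along an isogeny pair `(u, v, m)` -/

section Transport

variable {K : Type} [Field K] [NumberField K] {A B : AbelianVariety ℂ}
  {u : A ⟶ B} {v : B ⟶ A} {m : ℕ} (hm : 0 < m) (huv : u ≫ v = m • 𝟙 A) (hvu : v ≫ u = m • 𝟙 B)
  (φ : K →+* A.endAlgebra)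

/-- **Equivariance of `v^*` on complex cohomology**: for an isogeny pair `(u, v, m)` (`u ≫ v = m • 𝟙 A`, `v ≫ u = m • 𝟙 B`),
a rational structure `φ : K → End⁰(A)` and its transport `φ_B := End⁰(u,v,m) ∘ φ : K → End⁰(B)`:
`v^* ∘ complexAction φ k = complexAction φ_B k ∘ v^*` on `H¹(−(ℂ);ℂ)` — the tree's rational identity
`pull_comp_hOneAlgHom_transport` for the REVERSED pair `(v, u)` (its `hrel` discharged by `endAlgebraTransport_transport`),
complexified through the comparison `β`. [cite: MumfordAV1970, §19 Remark p. 169] -/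
theorem complexBetti_map_comp_complexAction_transport (k : K) :
    (complexBetti.map v.hom.hom.hom 1).hom ∘ₗ complexAction φ k =
      complexAction ((endAlgebraTransport u v m hm huv hvu).toRingHom.comp φ) k ∘ₗ
        (complexBetti.map v.hom.hom.hom 1).hom := by
  have hrat : BettiUniverse.pull v.hom.hom.hom 1 ∘ₗ hOneAlgHom φ k =
      hOneAlgHom ((endAlgebraTransport u v m hm huv hvu).toRingHom.comp φ) k ∘ₗ BettiUniverse.pull v.hom.hom.hom 1 :=
    pull_comp_hOneAlgHom_transport hm hvu huv ((endAlgebraTransport u v m hm huv hvu).toRingHom.comp φ) φ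
      (fun k => (endAlgebraTransport_transport hm huv hvu (φ k)).symm) k
  refine LinearMap.ext fun w => ?_
  obtain ⟨x, rfl⟩ := (βA A).surjective w
  have hβ : ∀ y : ℂ ⊗[ℚ] bettiCohomology A.X 1,
      (complexBetti.map v.hom.hom.hom 1).hom (βA A y) =
        βA B ((BettiUniverse.pull v.hom.hom.hom 1).baseChange ℂ y) := fun y =>
    complexBetti_map_ofRatClassBaseChangeEquiv (AbelianVariety.isSmoothProjective_holds (A := B))
      (AbelianVariety.isSmoothProjective_holds (A := A)) v.hom.hom.hom y
  rw [LinearMap.comp_apply, LinearMap.comp_apply, complexAction_βA, hβ, hβ, complexAction_βA,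
    ← LinearMap.comp_apply (f := (BettiUniverse.pull v.hom.hom.hom 1).baseChange ℂ),
    ← LinearMap.comp_apply (f := (hOneAlgHom _ k).baseChange ℂ),
    ← LinearMap.baseChange_comp, ← LinearMap.baseChange_comp, hrat]

/-- **Eigenlines go to eigenlines**: `α ∈ eigenline (complexAction φ) τ ⟹ v^*α ∈ eigenline (complexAction φ_B) τ`.
[cite: MumfordAV1970, §19 Remark p. 169] -/
theorem complexBetti_map_mem_eigenline_transport {τ : K →+* ℂ} {α : complexBetti A.X 1}
    (hα : α ∈ eigenline (complexAction φ) τ) :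
    (complexBetti.map v.hom.hom.hom 1).hom α ∈
      eigenline (complexAction ((endAlgebraTransport u v m hm huv hvu).toRingHom.comp φ)) τ := by
  rw [eigenline, Submodule.mem_iInf] at hα ⊢
  intro k
  have h := congrArg (fun L => L α) (complexBetti_map_comp_complexAction_transport hm huv hvu φ k)
  simp only [LinearMap.comp_apply] at h
  rw [Module.End.mem_eigenspace_iff, ← h, (Module.End.mem_eigenspace_iff.mp (hα k)), map_smul]

include huv in
/-- `u^*(v^*α) = m • α` on `H¹(A(ℂ);ℂ)` when `u ≫ v = m • 𝟙 A`. [cite: MumfordAV1970, §19 Remark p. 169] -/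
theorem complexBetti_map_map_of_comp_eq_nsmul (α : complexBetti A.X 1) :
    (complexBetti.map u.hom.hom.hom 1).hom ((complexBetti.map v.hom.hom.hom 1).hom α) = (m : ℂ) • α := by
  have h : (complexBetti.map (u ≫ v).hom.hom.hom 1).hom α =
      (complexBetti.map u.hom.hom.hom 1).hom ((complexBetti.map v.hom.hom.hom 1).hom α) := by
    rw [← ModuleCat.comp_apply, ← complexBetti.map_comp]; rfl
  rw [← h, huv, complexBetti_map_nsmul_one, show (𝟙 A : A ⟶ A).hom.hom.hom = 𝟙 A.X from rfl, complexBetti.map_id,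
    ModuleCat.hom_nsmul, LinearMap.smul_apply, ModuleCat.hom_id, LinearMap.id_apply, Nat.cast_smul_eq_nsmul]

include hm huv in
/-- `v^*` is injective on `H¹(A(ℂ);ℂ)` for an isogeny pair (`u^* v^* = m ≠ 0`). [cite: MumfordAV1970, §19 Remark p. 169] -/
theorem complexBetti_map_injective_of_comp_eq_nsmul : Function.Injective (complexBetti.map v.hom.hom.hom 1).hom := by
  intro α β h
  have hm' : (m : ℂ) ≠ 0 := Nat.cast_ne_zero.2 hm.ne'
  have := congrArg (complexBetti.map u.hom.hom.hom 1).hom h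
  rw [complexBetti_map_map_of_comp_eq_nsmul huv, complexBetti_map_map_of_comp_eq_nsmul huv] at this
  exact smul_right_injective _ hm' this

include hm huv in
/-- **The generator identity** (the consumed direction of the reading «Liu's generators lie in the span of the pulled-back classes
of `B`»): for every `f : P ⟶ A`, `f^*α = m⁻¹ • (f ≫ u)^*(v^*α)`. [cite: MumfordAV1970, §19 Remark p. 169] -/
theorem complexBetti_map_eq_inv_smul_map_comp (P : AbelianVariety ℂ) (f : P ⟶ A) (α : complexBetti A.X 1) :
    (complexBetti.map f.hom.hom.hom 1).hom α =
      ((m : ℂ)⁻¹) • (complexBetti.map (f ≫ u).hom.hom.hom 1).hom ((complexBetti.map v.hom.hom.hom 1).hom α) := by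
  have hm' : (m : ℂ) ≠ 0 := Nat.cast_ne_zero.2 hm.ne'
  have h2 : (f ≫ u).hom.hom.hom = f.hom.hom.hom ≫ u.hom.hom.hom := rfl
  rw [h2, complexBetti.map_comp, ModuleCat.comp_apply, complexBetti_map_map_of_comp_eq_nsmul huv, map_smul, smul_smul,
    inv_mul_cancel₀ hm', one_smul]

/-- **Transport of an eigenclass, packaged**: from the isogeny pair `(u, v, m)` and `φ`, with `φ_B := End⁰(u,v,m) ∘ φ`, every
non-zero `τ`-eigenclass `α` of `complexAction φ` yields `α_B := v^*α`, a NON-ZERO `τ`-eigenclass of `complexAction φ_B` with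
`f^*α = m⁻¹ • (f ≫ u)^* α_B` for every `f : P ⟶ A`. [cite: MumfordAV1970, §19 Remark p. 169] -/
theorem exists_eigenline_transport_of_isogenyPair {τ : K →+* ℂ} {α : complexBetti A.X 1}
    (hα : α ∈ eigenline (complexAction φ) τ) (hα0 : α ≠ 0) :
    ∃ αB : complexBetti B.X 1,
      αB ∈ eigenline (complexAction ((endAlgebraTransport u v m hm huv hvu).toRingHom.comp φ)) τ ∧ αB ≠ 0 ∧
      ∀ (P : AbelianVariety ℂ) (f : P ⟶ A),
        (complexBetti.map f.hom.hom.hom 1).hom α = ((m : ℂ)⁻¹) • (complexBetti.map (f ≫ u).hom.hom.hom 1).hom αB :=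
  ⟨(complexBetti.map v.hom.hom.hom 1).hom α, complexBetti_map_mem_eigenline_transport hm huv hvu φ hα,
    fun h => hα0 (complexBetti_map_injective_of_comp_eq_nsmul hm huv (h.trans (map_zero _).symm)),
    fun P f => complexBetti_map_eq_inv_smul_map_comp hm huv P f α⟩

end Transport

/-! ## §2  The principal record behind the determinant character: one complex abelian variety, one `A / E`, Def. 4.5 (2) data -/

section Core

variable {E : Type} [Field E] [Algebra E ℂ] {K : Type} [Field K] [NumberField K]

/-- **Principal form of `exists_isogeny_isCMTypeRealisation_of_det_complexAction`** (`CMTypeOfHodgeDeterminant.lean` :366): same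
hypotheses (full degree, `W = H^{1,0}` by membership, `φ`-stable, determinant character `= ∏_{σ ∈ Φ} σ` on `W`), conclusion = binder-1's
principal record (isogeny pair, integral transported action, realisation) — `cmType_eq_of_det_restrict_complexAction` followed by
`exists_principal_isCMTypeRealisation_of_cmType_eq`. [cite: Shimura1998, §5.2 (pp. 36–37) and §7.1 Proposition 7 (p. 47)]
[cite: Deligne1982HodgeCycles, §4 and Example 3.7] -/
theorem exists_principal_isCMTypeRealisation_of_det_complexAction {A : AbelianVariety ℂ}
    (hHD : exists_isReal_hodgeModel) (hI : hodgePQ_independent_of_hodgeModel) (φ : K →+* A.endAlgebra)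
    (hK : Module.finrank ℚ K = 2 * A.dim) (Φ : CMType K) (W : Submodule ℂ (complexBetti A.X 1))
    (hW : ∀ v, v ∈ W ↔ IsOfHodgeType A.dim A.X 1 1 0 v) (hst : ∀ k : K, ∀ v ∈ W, complexAction φ k v ∈ W)
    (hdet : ∀ k : K, k ≠ 0 → LinearMap.det ((complexAction φ k).restrict (hst k)) = ∏ᶠ σ ∈ Φ.1, σ k) :
    ∃ (B : AbelianVariety ℂ) (u : A ⟶ B) (v : B ⟶ A) (m : ℕ) (hm : 0 < m) (huv : u ≫ v = m • 𝟙 A)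
      (hvu : v ≫ u = m • 𝟙 B) (ιB : 𝓞 K →+* End B),
      AbelianVariety.IsIsogeny u ∧ AbelianVariety.IsIsogeny v ∧
      (∀ a : 𝓞 K, (endAlgebraTransport u v m hm huv hvu).toRingHom.comp φ a = endAlgebra.of B (ιB a)) ∧
      IsCMTypeRealisation Φ B ιB (complexAction ((endAlgebraTransport u v m hm huv hvu).toRingHom.comp φ)) :=
  exists_principal_isCMTypeRealisation_of_cmType_eq hHD hI φ hK Φ
    (cmType_eq_of_det_restrict_complexAction hHD hI φ hK Φ W hW hst hdet)

/-- **Principal form of `Model.exists_isogeny_isCMTypeRealisation_baseChange_of_detInvariant`** (`Item6PinMatchDet.lean` :125): ONE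
abelian variety `A / E`, a rational structure `φ` on `A ⊗_E ℂ` presented by base-changed endomorphisms (`hrat`) whose `E`-valued
invariant `δ` matches `η` with `η = ∏_{θ ∈ Ψ} θ` in `ℂ` (`hη`) and computes `det` on `H^{1,0}` (`hL2`) ⟹ the principal record for `Ψ`
on `A ⊗_E ℂ`.  The tree's proof verbatim with the last lemma replaced by `exists_principal_isCMTypeRealisation_of_det_complexAction`.
[cite: Shimura1998, §5.2 (pp. 36–37), §7.1 Proposition 7 (p. 47) and §18.5 (18.5b)] [cite: MumfordAV1970, §19 (p. 176)] -/
theorem exists_principal_isCMTypeRealisation_baseChange_of_detInvariant (A : AbelianVariety E)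
    (φ : K →+* (A.baseChange ℂ).endAlgebra) (hK : Module.finrank ℚ K = 2 * A.dim) (Ψ : CMType K)
    (δ : End A → E) (η : K → E)
    (hrat : ∀ k : K, k ≠ 0 → ∃ (n : ℕ) (f : End A), n ≠ 0 ∧
      φ k = algebraMap ℚ (A.baseChange ℂ).endAlgebra ((n : ℚ)⁻¹) *
        AbelianVariety.endAlgebra.of (A.baseChange ℂ) (AbelianVariety.Hom.baseChange ℂ f) ∧
      δ f = (n : E) ^ A.dim * η k)
    (hη : ∀ k : K, k ≠ 0 → algebraMap E ℂ (η k) = ∏ᶠ θ ∈ Ψ.1, θ k)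
    (hL2 : ∀ f : End A,
      LinearMap.det ((complexBetti.map (AbelianVariety.Hom.baseChange ℂ f).hom.hom.hom 1).hom.restrict
        (fun _ hv => map_mem_hodgeOneZero (AbelianVariety.isSmoothProjective_holds (A := A.baseChange ℂ))
          (AbelianVariety.Hom.baseChange ℂ f).hom.hom.hom hv)) = algebraMap E ℂ (δ f)) :
    ∃ (B : AbelianVariety ℂ) (u : A.baseChange ℂ ⟶ B) (v : B ⟶ A.baseChange ℂ) (m : ℕ) (hm : 0 < m)
      (huv : u ≫ v = m • 𝟙 (A.baseChange ℂ)) (hvu : v ≫ u = m • 𝟙 B) (ιB : 𝓞 K →+* End B),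
      AbelianVariety.IsIsogeny u ∧ AbelianVariety.IsIsogeny v ∧
      (∀ a : 𝓞 K, (endAlgebraTransport u v m hm huv hvu).toRingHom.comp φ a = endAlgebra.of B (ιB a)) ∧
      IsCMTypeRealisation Ψ B ιB (complexAction ((endAlgebraTransport u v m hm huv hvu).toRingHom.comp φ)) := by
  have hXℂ := AbelianVariety.isSmoothProjective_holds (A := A.baseChange ℂ)
  have hW : ∀ v, v ∈ hodgeOneZero hXℂ ↔ IsOfHodgeType (A.baseChange ℂ).dim (A.baseChange ℂ).X 1 1 0 v :=
    fun _ => Iff.rfl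
  have hst : ∀ k : K, ∀ v ∈ hodgeOneZero hXℂ, complexAction φ k v ∈ hodgeOneZero hXℂ :=
    fun k _ hv => complexAction_mem_of_mem_iff exists_isReal_hodgeModel_holds hodgePQ_independent_of_hodgeModel_holds
      φ _ hW k hv
  have hKℂ : Module.finrank ℚ K = 2 * (A.baseChange ℂ).dim := by
    rw [AbelianVariety.dim_baseChange]; exact hK
  refine exists_principal_isCMTypeRealisation_of_det_complexAction exists_isReal_hodgeModel_holds
    hodgePQ_independent_of_hodgeModel_holds φ hKℂ Ψ (hodgeOneZero hXℂ) hW hst fun k hk => ?_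
  obtain ⟨n, f, hn, hφ, hδ⟩ := hrat k hk
  have hact := complexAction_eq_smul_map_of_eq φ k ((n : ℚ)⁻¹) (AbelianVariety.Hom.baseChange ℂ f) hφ
  rw [restrict_eq_smul_restrict (((n : ℚ)⁻¹ : ℚ) : ℂ) hact (hst k)
    (fun _ hv => map_mem_hodgeOneZero hXℂ (AbelianVariety.Hom.baseChange ℂ f).hom.hom.hom hv),
    LinearMap.det_smul, hL2 f, hδ, map_mul, map_pow, map_natCast, hη k hk,
    AbelianVariety.finrank_hodgeOneZero_eq_dim (A.baseChange ℂ) hXℂ, AbelianVariety.dim_baseChange]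
  have hn' : (n : ℂ) ≠ 0 := Nat.cast_ne_zero.2 hn
  rw [Rat.cast_inv, Rat.cast_natCast, inv_pow, ← mul_assoc, inv_mul_cancel₀ (pow_ne_zero _ hn'), one_mul]

end Core

/-- **Principal form of `Model.exists_isogeny_isCMTypeRealisation_baseChange_of_det45`** (`Item6PinMatchDef45.lean` :129): from
[Liu 2021] Def. 4.5 (2) data AS PRINTED — `A / F`, the RATIONAL structure `i : M_μ → End⁰(A)` («`i_μ` is a CM structure»,
l. 1948: `[M_μ:ℚ] = 2 dim A`), the FIRST BULLET (l. 1950) on the cotangent space with Liu's DEFINED `η_μ = Def45.eta` — plus the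
Hodge comparison `hW` and the base-change law `hdetBC`: the principal record for the inflated reflex type
`inducedCMType e (reflexCMType σ Φ_μ id)` on `A ⊗_{F,σ} ℂ`, the rational structure on the pin being `i_ℂ := End⁰(baseChange) ∘ i` and
the INTEGRAL action on `B` its transport along `(u, v, m)` restricted to `𝓞_{M_μ}`.  The tree's proof verbatim, principal tail.
[cite: Liu2021, Def. 4.5 (1)–(2) (FJcycle.tex ll. 1939–1951), Def. 4.3 (2) (l. 1919) and §4.1 l. 1928]
[cite: Shimura1998, §5.2 (pp. 36–37) and §7.1 Proposition 7 (p. 47)] -/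
theorem exists_principal_isCMTypeRealisation_baseChange_of_det45 (hW : cotangent_hodge10_comparison)
    (hdetBC : ∀ (K : Type) [Field K] (L : Type) [Field L] [Algebra K L] (A : AbelianVariety K) (u : A ⟶ A),
      LinearMap.det (AbelianVariety.cotangentMap (A.baseChange L) (AbelianVariety.Hom.baseChange L u)) =
        algebraMap K L (LinearMap.det (AbelianVariety.cotangentMap A u)))
    {F : Type} [Field F] [NumberField F] [IsCMField F] [IsGalois ℚ F] (σ : F →+* ℂ)
    {μ : IdeleClassGroup F →ₜ* Circle} (hμ : IsConjugateSymplectic F μ)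
    (A : AbelianVariety F) (i : muAlgValueField F μ →+* A.endAlgebra)
    (hdim : Module.finrank ℚ (muAlgValueField F μ) = 2 * A.dim)
    (hdet45 : ∀ (x : muAlgValueField F μ) (M : ℕ) (f : End A), M ≠ 0 →
      i x = algebraMap ℚ A.endAlgebra (M : ℚ)⁻¹ * AbelianVariety.endAlgebra.of A f →
        LinearMap.det (AbelianVariety.cotangentMap A f) = (M : F) ^ A.dim * Def45.eta (AlgHom.id ℚ F) σ hμ x)
    (e : reflexField ℚ F (algValuedIn σ hμ.cmType.1) →+* muAlgValueField F μ)
    (he : ∀ k : reflexField ℚ F (algValuedIn σ hμ.cmType.1), ((e k : muAlgValueField F μ) : ℂ) = σ k) :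
    haveI := hμ.numberField_muAlgValueField
    letI := σ.toAlgebra
    ∃ (B : AbelianVariety ℂ) (u : A.baseChange ℂ ⟶ B) (v : B ⟶ A.baseChange ℂ) (m : ℕ) (hm : 0 < m)
      (huv : u ≫ v = m • 𝟙 (A.baseChange ℂ)) (hvu : v ≫ u = m • 𝟙 B) (ιB : 𝓞 (muAlgValueField F μ) →+* End B),
      AbelianVariety.IsIsogeny u ∧ AbelianVariety.IsIsogeny v ∧
      (∀ a : 𝓞 (muAlgValueField F μ), (endAlgebraTransport u v m hm huv hvu).toRingHom.comp
        ((AbelianVariety.endAlgebra.mapRingHom (A.endBaseChange ℂ)).toRingHom.comp i) a = endAlgebra.of B (ιB a)) ∧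
      IsCMTypeRealisation (inducedCMType e (reflexCMType σ hμ.cmType (AlgHom.id ℚ F))) B ιB
        (complexAction ((endAlgebraTransport u v m hm huv hvu).toRingHom.comp
          ((AbelianVariety.endAlgebra.mapRingHom (A.endBaseChange ℂ)).toRingHom.comp i))) := by
  letI := σ.toAlgebra
  haveI := hμ.numberField_muAlgValueField
  refine exists_principal_isCMTypeRealisation_baseChange_of_detInvariant A
    ((AbelianVariety.endAlgebra.mapRingHom (A.endBaseChange ℂ)).toRingHom.comp i) hdim _
    (fun f => LinearMap.det (AbelianVariety.cotangentMap A f)) (Def45.eta (AlgHom.id ℚ F) σ hμ)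
    (fun k _ => ?_) (fun k _ => ?_) (fun f => ?_)
  · obtain ⟨M, f, hM, hkf⟩ := AbelianVariety.endAlgebra.exists_eq_algebraMap_mul_of (i k)
    exact ⟨M, f, hM, endAlgebra_mapRingHom_endBaseChange_eq A i hkf, hdet45 k M f hM hkf⟩
  · have hη := Def45.apply_eta_eq_finprod_of_coe_eq (AlgHom.id ℚ F) σ hμ e he k
    rw [AlgHom.id_apply] at hη
    rw [RingHom.algebraMap_toAlgebra]
    exact hη
  · rw [hW.det_restrict_hodgeOneZero_eq_det_cotangentMap (A.baseChange ℂ) (AbelianVariety.Hom.baseChange ℂ f),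
      hdetBC F ℂ A f]

/-! ## §3  The face-guarded family: the principal form of the binder `hCMisogE` -/

section Family

/-- **Principal ∕ equivariant form of `Model.hCMisogE_of_det45`** (`Item6PinMatchDef45.lean` :203): the SAME cite-binders `hW`
(= `cotangent_hodge10_comparison_holds`), `hdetBC` (= `AbelianVariety.det_cotangentMap_baseChange`), carriers `D` (Thm. 4.18 data),
`Aμ₀` (l. 1946), `iμ₀` (l. 1948, RATIONAL) and binders `hdim`, `hdet45` (first bullet l. 1950), token-identical; conclusion, at every
face `IsGalois ℚ F → 6 ≤ [F:ℚ] → ι₁ ∈ Φ` and for the inclusion `e` with `(e k : ℂ) = ι₁ k`: the principal record — an isogeny pair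
`(u, v, m)` between `A_μ ⊗_{E,ι₁} ℂ` and `B`, an INTEGRAL `ιB : 𝓞_{M_μ} → End B` equal on `𝓞_{M_μ}` to the transport of
`i_{μ,ℂ}`, and `(B, ιB, complexAction (transport ∘ i_{μ,ℂ}))` realising `inducedCMType e_μ (reflexCMType ι₁ Φ_μ id)`.  Proof: §2
face by face.  No binder is inhabited here; HC_CM is NOT proved.
[cite: Liu2021, Def. 4.5 (1)–(2) (FJcycle.tex ll. 1939–1951), Def. 4.3 (2) (l. 1919) and §4.1 l. 1928]
[cite: Shimura1998, §5.2 (pp. 36–37) and §7.1 Proposition 7 (p. 47)] [cite: MumfordAV1970, §19 Remark p. 169] -/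
theorem hCMisogE_of_det45_principal (hW : cotangent_hodge10_comparison)
    (hdetBC : ∀ (K : Type) [Field K] (L : Type) [Field L] [Algebra K L] (A : AbelianVariety K) (u : A ⟶ A),
      LinearMap.det (AbelianVariety.cotangentMap (A.baseChange L) (AbelianVariety.Hom.baseChange L u)) =
        algebraMap K L (LinearMap.det (AbelianVariety.cotangentMap A u)))
    (D : ∀ (F : CMField) (ι₁ : F →+* ℂ) (_ : HermSpace3 F ι₁) (_ : CMType F), Thm418Data (maximalRealSubfield F) F)
    (Aμ₀ : ∀ (F : CMField) (ι₁ : F →+* ℂ) (V : HermSpace3 F ι₁) (Φ : CMType F), (D F ι₁ V Φ).Obj → AbelianVariety F)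
    (iμ₀ : ∀ (F : CMField) (ι₁ : F →+* ℂ) (V : HermSpace3 F ι₁) (Φ : CMType F) (Dμ : (D F ι₁ V Φ).Obj),
      muAlgValueField F (D F ι₁ V Φ).μ →+* (Aμ₀ F ι₁ V Φ Dμ).endAlgebra)
    (hdim : ∀ (F : CMField) [IsGalois ℚ F], 6 ≤ Module.finrank ℚ F → ∀ (Φ : CMType F) (ι₁ : F →+* ℂ), ι₁ ∈ Φ.1 →
      ∀ (V : HermSpace3 F ι₁) (Dμ : (D F ι₁ V Φ).Obj),
        Module.finrank ℚ (muAlgValueField F (D F ι₁ V Φ).μ) = 2 * (Aμ₀ F ι₁ V Φ Dμ).dim)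
    (hdet45 : ∀ (F : CMField) [IsGalois ℚ F], 6 ≤ Module.finrank ℚ F → ∀ (Φ : CMType F) (ι₁ : F →+* ℂ), ι₁ ∈ Φ.1 →
      ∀ (V : HermSpace3 F ι₁) (Dμ : (D F ι₁ V Φ).Obj) (x : muAlgValueField F (D F ι₁ V Φ).μ) (M : ℕ)
        (f : End (Aμ₀ F ι₁ V Φ Dμ)), M ≠ 0 →
        iμ₀ F ι₁ V Φ Dμ x =
          algebraMap ℚ (Aμ₀ F ι₁ V Φ Dμ).endAlgebra (M : ℚ)⁻¹ * AbelianVariety.endAlgebra.of (Aμ₀ F ι₁ V Φ Dμ) f →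
        LinearMap.det (AbelianVariety.cotangentMap (Aμ₀ F ι₁ V Φ Dμ) f) =
          (M : F) ^ (Aμ₀ F ι₁ V Φ Dμ).dim * Def45.eta (AlgHom.id ℚ F) ι₁ (D F ι₁ V Φ).isConjugateSymplectic x) :
    ∀ (F : CMField) [IsGalois ℚ F], 6 ≤ Module.finrank ℚ F → ∀ (Φ : CMType F) (ι₁ : F →+* ℂ), ι₁ ∈ Φ.1 →
      ∀ (V : HermSpace3 F ι₁) (Dμ : (D F ι₁ V Φ).Obj),
        haveI := (D F ι₁ V Φ).isConjugateSymplectic.numberField_muAlgValueField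
        ∀ e : reflexField ℚ F (algValuedIn ι₁ (D F ι₁ V Φ).cmType.1) →+* muAlgValueField F (D F ι₁ V Φ).μ,
          (∀ k : reflexField ℚ F (algValuedIn ι₁ (D F ι₁ V Φ).cmType.1),
            ((e k : muAlgValueField F (D F ι₁ V Φ).μ) : ℂ) = ι₁ k) →
          letI := ι₁.toAlgebra
          ∃ (B : AbelianVariety ℂ) (u : (Aμ₀ F ι₁ V Φ Dμ).baseChange ℂ ⟶ B) (v : B ⟶ (Aμ₀ F ι₁ V Φ Dμ).baseChange ℂ)
            (m : ℕ) (hm : 0 < m) (huv : u ≫ v = m • 𝟙 ((Aμ₀ F ι₁ V Φ Dμ).baseChange ℂ)) (hvu : v ≫ u = m • 𝟙 B)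
            (ιB : 𝓞 (muAlgValueField F (D F ι₁ V Φ).μ) →+* End B),
            AbelianVariety.IsIsogeny u ∧ AbelianVariety.IsIsogeny v ∧
            (∀ a : 𝓞 (muAlgValueField F (D F ι₁ V Φ).μ), (endAlgebraTransport u v m hm huv hvu).toRingHom.comp
              ((AbelianVariety.endAlgebra.mapRingHom ((Aμ₀ F ι₁ V Φ Dμ).endBaseChange ℂ)).toRingHom.comp
                (iμ₀ F ι₁ V Φ Dμ)) a = endAlgebra.of B (ιB a)) ∧
            IsCMTypeRealisation (inducedCMType e (reflexCMType ι₁ (D F ι₁ V Φ).cmType (AlgHom.id ℚ F))) B ιB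
              (complexAction ((endAlgebraTransport u v m hm huv hvu).toRingHom.comp
                ((AbelianVariety.endAlgebra.mapRingHom ((Aμ₀ F ι₁ V Φ Dμ).endBaseChange ℂ)).toRingHom.comp
                  (iμ₀ F ι₁ V Φ Dμ)))) := by
  intro F _ h6 Φ ι₁ hι V Dμ e he
  exact exists_principal_isCMTypeRealisation_baseChange_of_det45 hW hdetBC ι₁ (D F ι₁ V Φ).isConjugateSymplectic
    (Aμ₀ F ι₁ V Φ Dμ) (iμ₀ F ι₁ V Φ Dμ) (hdim F h6 Φ ι₁ hι V Dμ) (hdet45 F h6 Φ ι₁ hι V Dμ) e he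

/-- **The export is recovered**: the principal family (conclusion of `hCMisogE_of_det45_principal`, taken as the one hypothesis
`hP`) implies, at every face, the `∃`-tail of `Model.hCMisogE_of_det45` — i.e. EXACTLY the binder `hCMisogE` of the END displays
(forget `v`, `m` and the transport equation).  Nothing the S2 junctions consume is lost by recording the stronger form.
[cite: Liu2021, Def. 4.5 (2) (FJcycle.tex ll. 1944–1951)] [cite: Shimura1998, §7.1 Proposition 7 (p. 47)] -/
theorem hCMisogE_of_principal
    (D : ∀ (F : CMField) (ι₁ : F →+* ℂ) (_ : HermSpace3 F ι₁) (_ : CMType F), Thm418Data (maximalRealSubfield F) F)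
    (Aμ₀ : ∀ (F : CMField) (ι₁ : F →+* ℂ) (V : HermSpace3 F ι₁) (Φ : CMType F), (D F ι₁ V Φ).Obj → AbelianVariety F)
    (iμ₀ : ∀ (F : CMField) (ι₁ : F →+* ℂ) (V : HermSpace3 F ι₁) (Φ : CMType F) (Dμ : (D F ι₁ V Φ).Obj),
      muAlgValueField F (D F ι₁ V Φ).μ →+* (Aμ₀ F ι₁ V Φ Dμ).endAlgebra)
    (hP : ∀ (F : CMField) [IsGalois ℚ F], 6 ≤ Module.finrank ℚ F → ∀ (Φ : CMType F) (ι₁ : F →+* ℂ), ι₁ ∈ Φ.1 →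
      ∀ (V : HermSpace3 F ι₁) (Dμ : (D F ι₁ V Φ).Obj),
        haveI := (D F ι₁ V Φ).isConjugateSymplectic.numberField_muAlgValueField
        ∀ e : reflexField ℚ F (algValuedIn ι₁ (D F ι₁ V Φ).cmType.1) →+* muAlgValueField F (D F ι₁ V Φ).μ,
          (∀ k : reflexField ℚ F (algValuedIn ι₁ (D F ι₁ V Φ).cmType.1),
            ((e k : muAlgValueField F (D F ι₁ V Φ).μ) : ℂ) = ι₁ k) →
          letI := ι₁.toAlgebra
          ∃ (B : AbelianVariety ℂ) (u : (Aμ₀ F ι₁ V Φ Dμ).baseChange ℂ ⟶ B) (v : B ⟶ (Aμ₀ F ι₁ V Φ Dμ).baseChange ℂ)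
            (m : ℕ) (hm : 0 < m) (huv : u ≫ v = m • 𝟙 ((Aμ₀ F ι₁ V Φ Dμ).baseChange ℂ)) (hvu : v ≫ u = m • 𝟙 B)
            (ιB : 𝓞 (muAlgValueField F (D F ι₁ V Φ).μ) →+* End B),
            AbelianVariety.IsIsogeny u ∧ AbelianVariety.IsIsogeny v ∧
            (∀ a : 𝓞 (muAlgValueField F (D F ι₁ V Φ).μ), (endAlgebraTransport u v m hm huv hvu).toRingHom.comp
              ((AbelianVariety.endAlgebra.mapRingHom ((Aμ₀ F ι₁ V Φ Dμ).endBaseChange ℂ)).toRingHom.comp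
                (iμ₀ F ι₁ V Φ Dμ)) a = endAlgebra.of B (ιB a)) ∧
            IsCMTypeRealisation (inducedCMType e (reflexCMType ι₁ (D F ι₁ V Φ).cmType (AlgHom.id ℚ F))) B ιB
              (complexAction ((endAlgebraTransport u v m hm huv hvu).toRingHom.comp
                ((AbelianVariety.endAlgebra.mapRingHom ((Aμ₀ F ι₁ V Φ Dμ).endBaseChange ℂ)).toRingHom.comp
                  (iμ₀ F ι₁ V Φ Dμ))))) :
    ∀ (F : CMField) [IsGalois ℚ F], 6 ≤ Module.finrank ℚ F → ∀ (Φ : CMType F) (ι₁ : F →+* ℂ), ι₁ ∈ Φ.1 →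
      ∀ (V : HermSpace3 F ι₁) (Dμ : (D F ι₁ V Φ).Obj),
        haveI := (D F ι₁ V Φ).isConjugateSymplectic.numberField_muAlgValueField
        ∀ e : reflexField ℚ F (algValuedIn ι₁ (D F ι₁ V Φ).cmType.1) →+* muAlgValueField F (D F ι₁ V Φ).μ,
          (∀ k : reflexField ℚ F (algValuedIn ι₁ (D F ι₁ V Φ).cmType.1),
            ((e k : muAlgValueField F (D F ι₁ V Φ).μ) : ℂ) = ι₁ k) →
          ∃ (B : AbelianVariety ℂ) (g : (letI := ι₁.toAlgebra; (Aμ₀ F ι₁ V Φ Dμ).baseChange ℂ) ⟶ B),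
            AbelianVariety.IsIsogeny g ∧
            ∃ (ιB : 𝓞 (muAlgValueField F (D F ι₁ V Φ).μ) →+* End B)
              (θB : muAlgValueField F (D F ι₁ V Φ).μ →+* Module.End ℂ (complexBetti B.X 1)),
              IsCMTypeRealisation (inducedCMType e (reflexCMType ι₁ (D F ι₁ V Φ).cmType (AlgHom.id ℚ F))) B ιB θB := by
  intro F _ h6 Φ ι₁ hι V Dμ
  haveI := (D F ι₁ V Φ).isConjugateSymplectic.numberField_muAlgValueField
  intro e he
  obtain ⟨B, u, v, m, hm, huv, hvu, ιB, hu, -, -, hreal⟩ := hP F h6 Φ ι₁ hι V Dμ e he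
  exact ⟨B, u, hu, ιB, _, hreal⟩

end Family

/-! ## §4  R-X2a end to end: the principal record transports Liu's eigenclass with the generator identity -/

/-- **R-X2a, end to end.**  From the principal record of `(Φ, A, φ)` (isogeny pair `(u, v, m)`, integral transported action `ιB`,
realisation with `θB := complexAction (transport ∘ φ)`) and a NON-ZERO `τ`-eigenclass `α ∈ H¹(A(ℂ);ℂ)` of `complexAction φ`: there are
`B`, an ISOGENY `u : A ⟶ B`, `ιB`, `θB` realising `Φ` on `B` (the exported `∃`-tail), `m > 0` and a NON-ZERO `τ`-eigenclass `α_B` of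
`θB` with `f^*α = m⁻¹ • (f ≫ u)^* α_B` for every `f : P ⟶ A` — the record `(B, ιB, θB, α_B)` is admissible-shaped (`α_mem`) and its
pulled-back classes span Liu's generators `f^*α` (§1 at `α_B := v^*α`).
[cite: MumfordAV1970, §19 Remark p. 169] [cite: Shimura1998, §7.1 Proposition 7 (p. 47)] -/
theorem exists_isCMTypeRealisation_eigenline_transport_of_principal {K : Type} [Field K] [NumberField K] {Φ : CMType K}
    {A : AbelianVariety ℂ} {φ : K →+* A.endAlgebra}
    (h : ∃ (B : AbelianVariety ℂ) (u : A ⟶ B) (v : B ⟶ A) (m : ℕ) (hm : 0 < m) (huv : u ≫ v = m • 𝟙 A)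
      (hvu : v ≫ u = m • 𝟙 B) (ιB : 𝓞 K →+* End B),
      AbelianVariety.IsIsogeny u ∧ AbelianVariety.IsIsogeny v ∧
      (∀ a : 𝓞 K, (endAlgebraTransport u v m hm huv hvu).toRingHom.comp φ a = endAlgebra.of B (ιB a)) ∧
      IsCMTypeRealisation Φ B ιB (complexAction ((endAlgebraTransport u v m hm huv hvu).toRingHom.comp φ)))
    {τ : K →+* ℂ} {α : complexBetti A.X 1} (hα : α ∈ eigenline (complexAction φ) τ) (hα0 : α ≠ 0) :
    ∃ (B : AbelianVariety ℂ) (u : A ⟶ B) (ιB : 𝓞 K →+* End B) (θB : K →+* Module.End ℂ (complexBetti B.X 1))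
      (m : ℕ) (αB : complexBetti B.X 1),
      AbelianVariety.IsIsogeny u ∧ IsCMTypeRealisation Φ B ιB θB ∧ 0 < m ∧ αB ∈ eigenline θB τ ∧ αB ≠ 0 ∧
      ∀ (P : AbelianVariety ℂ) (f : P ⟶ A),
        (complexBetti.map f.hom.hom.hom 1).hom α = ((m : ℂ)⁻¹) • (complexBetti.map (f ≫ u).hom.hom.hom 1).hom αB := by
  obtain ⟨B, u, v, m, hm, huv, hvu, ιB, hu, -, -, hreal⟩ := h
  obtain ⟨αB, hαB, hαB0, hgen⟩ := exists_eigenline_transport_of_isogenyPair hm huv hvu φ hα hα0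
  exact ⟨B, u, ιB, _, m, αB, hu, hreal, hm, hαB, hαB0, hgen⟩

end Summit.HodgeConjecture.CorCM.Model

end
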